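import Summits.BirchSwinnertonDyer.BirchSwinnertonDyer.Theorems.ByReductionTypeAtTwoSupersingularFlatAwayTrivialInfty
import Summits.BirchSwinnertonDyer.BirchSwinnertonDyer.Theorems.ThetaPartnerAtTwoSignedMainConjectureCMTwoRankZeroPTDeepSelmerTransport
import Summits.BirchSwinnertonDyer.BirchSwinnertonDyer.Theorems.ThetaPartnerAtTwoSignedMainConjectureCMTwoRankZeroPTDeepAdmissibleTransport
import Summits.BirchSwinnertonDyer.BirchSwinnertonDyer.Theorems.ThetaPartnerAtTwoSignedMainConjectureCMTwoRankZeroPTDeepLocalTransport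
import Summits.BirchSwinnertonDyer.BirchSwinnertonDyer.Theorems.SchneiderFreeAdditiveX3PoitouTateReciprocitySumHolds
import Summits.BirchSwinnertonDyer.BirchSwinnertonDyer.Theorems.ByReductionTypeAtTwoSupersingularFlatLayerIntegralBridge
import Literature.NumberTheory.GaloisCohomology.PoitouTateFiniteUnramifiedOrthogonalRamified
import Literature.NumberTheory.GaloisCohomology.PoitouTateSelmerStructuresCanonicalLift
import Literature.NumberTheory.EllipticCurves.BSDConductorProofs
import HarnessLib

/-!
# Route `ByReductionTypeAtTwo` (rung K4), crux `SupersingularRankZeroAtTwo` (item stmt-BirchSwinnertonDyer-19097), line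
# `odd_blind_package` v2.18, stub `stub_flatPackage`, conjunct (8), clause F1♭ `Exact loc toX` — **THE LEVELWISE SUPPLIER (S-LEV)
# `ORTH w → LEV w` AND T-LIM BY NAME**: the finite-level one-place Poitou–Tate converse over the layer `ℚ_n` with coefficients
# `W[p^k]`, INTEGRAL output, ♭-test points as local condition at `v ∣ p`, in the Shapiro model over `ℚ` (cell `bsd-2adic`, seat
# `bsd-2adic-t42` GEN 50, hand hF1♭-LEV, FILE 3; `--supports 19097`, helper)

HONEST FRAMING (D-0054): THEOREMS ONLY — no definition, no named fact, no instance, no notation, no `sorry`.  Helpers toward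
conjunct (8); close NO stub; 19097 stays OPEN on its 5 registered stubs (v2.18); nothing is booked; BSD₂ is proved for no
supersingular curve and BSD for no curve by any of this; typed ≠ proved.  Generic prime `p`, cyclotomic `κ` over `ℚ`, `v ∣ p`;
no ×2, no `m₀`; key-agnostic (no `D`, `Y`, `ν`, `γ⁻¹`).

## What

* (FILE 3a `…FlatLayerIntegralBridge`: `forall_primesAbove_resLe_eq_zero_of_localization_shapiroLift_mem` — «`loc_u (Sh c)` unramified ⟹
  `c` integral at `u`» at ANY finite `u`, ramified places of the coefficient module included.)
* ★★ `levelwise_of_orth (hκ) (hv) (hg) (hap) (hc) (hTr) (w) (hw : ORTH w) : LEV w` — LEV VERBATIM the binder `hlev` of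
  `SSFlatPT.exists_snd_coleman_apply_eq_of_levelwise` (p831689), ORTH VERBATIM its consumer's.  PROOF = the K2R0P♭ socket
  `SignedLowerOffTwo.PTDeep.levelwisePoitouTate_of_transfer` re-run at level `(n, k)` with: `ρc := Maps(Γ_ℚ ⧸ Γ_n, W[p^k])`
  (`DiscreteGaloisModule.coind`), `S := {∞} ∪ {p} ∪ bad`, `𝓖 :=` UNRAMIFIED at EVERY finite `u ∌ p` (bad places included), `⊤` at
  `v` and at `∞`; `𝓕 := 𝓖` with `𝓕_v := C^⊥`, `C := T_v(Sh_v(κ(T♭)))` for the ♭-TEST subgroup `T♭ = {Q ∈ E(ℚ_{n,v}) : p^k ∣ z'(Q) ∀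
  z' ∈ Ker Col♭}`, character `χ_w : C → ℤ/p^k`, `T_v Sh_v κ Q ↦ w(Q) mod p^k` (well defined: `toZModPow_mul_eq_zero_of_layerKummer_eq_zero`);
  orthogonality on `H¹_{𝓕*}(ℚ, ρc^D)`: `y = H¹(Ψ)(Sh b)` (`existsUnique_shapiroLift_coindTateDual_eq`), `b` is integral at EVERY `u ∌ p`
  (the dual of «unramified» is «unramified» for the RAMIFIED `ρc` too — Milne I 2.6 as printed,
  `dualLocalCondition_canonical_unramifiedSubgroup_eq_of_primePow`, then `localization_mem_unramifiedSubgroup_of_coindTateDual` and §1),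
  locally trivial at `∞` (`⊤^⊥ = 0` + `resOfLe_decompInf_conjH1_eq_zero_of_localization_shapiroLift_eq_zero`) and `layerLoc b = layerKummer Q₀`
  for a ♭-test `Q₀`, whence the transfer brick (T♭) `toZModPow_apply_eq_zero_of_orth_of_integral` (p833547) gives `χ_w(loc_v y) = 0`;
  the one-place lift `LocalInvariants.exists_selmer_canonical_localTatePairing_eq_of_subgroup` over
  `SchneiderFreeAdditiveX3.PoitouTateReduction.poitouTate_selmerStructure_duality_real_holds ℚ` produces `X ∈ H¹_𝓖(ℚ, ρc)`; `a := Sh⁻¹ X` is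
  INTEGRAL (`Kato2004.integralH1`, by §1 at every `u ∌ p`) and `⟨a, Q⟩_{n,p^k} = χ_w(c_Q) = w(Q) mod p^k` on `T♭`
  (`cohomologyMap_coindFinPull_localization_shapiroLift`, `layerPairingMod_apply`).
* (FILE 4 `…FlatPTLimitOfOrth`: T-LIM `exists_snd_coleman_apply_eq_of_orth` = ONE `exact` of p831689 with FIN := p832982 and LEV := this file.)

References: [MilneADT2006] I Thm. 2.6, Cor. 2.3, Thm. 2.13 (a), Thm. 4.10 (b); [Howard2004HeegnerKolyvagin] Thm. 2.1.11;
[NeukirchSchmidtWingberg2008] I §6 (1.6.4)–(1.6.5); [Kobayashi2003] (7.17)–(7.21), (8.23); [Sprung2012] Def. 7.9, 7.11; [Kato2004Asterisque]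
§8.2 Lemma 8.5, §12.2, §17.13; [GreenbergLNM1716] §4 p. 122.
-/

set_option autoImplicit false
-- the Theorems namespace of this sub repeats the summit name by design (D-0017 nested layout)
set_option linter.dupNamespace false

noncomputable section

open scoped Classical NumberField

namespace Summit.BirchSwinnertonDyer.BirchSwinnertonDyer.Theorems

namespace SSFlatPT

open CategoryTheory Field NumberField IsDedekindDomain WeierstrassCurve ContinuousCohomology
  Literature.NumberTheory.EllipticCurves Literature.NumberTheory.EllipticCurves.CyclotomicLayer
  Literature.NumberTheory.EllipticCurves.Kobayashi2003 Literature.NumberTheory.EllipticCurves.Sprung2012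
  Literature.NumberTheory.EllipticCurves.Sprung2017
  Literature.NumberTheory.EllipticCurves.GreenbergSelmer Literature.NumberTheory.EllipticCurves.Rank1Residual
  Literature.NumberTheory.EllipticCurves.Kato2004 Literature.NumberTheory.EllipticCurves.Kato2004.EulerSystemValues
  Literature.NumberTheory.GaloisRepresentations Literature.NumberTheory.GaloisRepresentations.DiscreteGaloisModule
  Literature.NumberTheory.GaloisCohomology Literature.NumberTheory.GaloisCohomology.PoitouTateFinite
  ZpExtension Rat.HeightOneSpectrum Summit.BirchSwinnertonDyer.Rank1Residual.Supersingular
  Summit.BirchSwinnertonDyer.Rank1Residual.X11b.LocBridge SignedLowerOffTwo.PTDeep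

/-! ## ★★ The levelwise supplier: `ORTH w → LEV w` -/

-- Cup products need `LocallyCompactSpace Γ`; as in the K3 layer files the compactness of absolute Galois groups is supplied
-- inside the proof (`haveI`), and `E[N]` is finite.

variable (W : WeierstrassCurve ℚ) [W.IsElliptic] {p : ℕ} [Fact p.Prime] (κ : ZpExtension ℚ p) (v : HeightOneSpectrum (𝓞 ℚ))
  {ap : ℤ} {g : absoluteGaloisGroup (v.adicCompletion ℚ)} {c : ℕ → localPoints W (v.adicCompletion ℚ)}

-- one `(n, k)`-level assembly of the K2R0P♭ bricks in a single declaration (as in `…PTDeepSelmerSocket`)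
set_option maxHeartbeats 400000 in
/-- ★★ **S-LEV: the levelwise one-place Poitou–Tate converse for `w`, `ORTH w → LEV w`** (LEV = the binder `hlev` of
`SSFlatPT.exists_snd_coleman_apply_eq_of_levelwise`, VERBATIM; ORTH = its consumer's hypothesis, VERBATIM).  For the cyclotomic `κ`,
`v ∣ p`, a local `g` restricting to a topological generator, `p ∣ a_p`, Honda levels with the trace relations, and a functional `w` on
`E(ℚ_∞·ℚ_v)` whose Kummer values on ♭-Selmer data vanish: for every `(n, k)` there is an INTEGRAL class `a ∈ H¹(Γ_n, W[p^k])`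
(`Kato2004.integralH1`: unramified at every `ℓ ≠ p` at class level, bad places included) with `⟨a, Q⟩_{n,p^k} = w(Q) mod p^k` for every
♭-TEST point `Q ∈ E(ℚ_{n,v})` of level `k`.  Construction: module docstring §2 (Milne I 4.10 (b) for THE canonical maps on
`Maps(Γ_ℚ ⧸ Γ_n, W[p^k])`, the K2R0P♭ Shapiro dictionary, Milne I 2.6 at the bad places, the transfer brick (T♭)).
[cite: MilneADT2006, Ch. I, Thm. 4.10(b), Thm. 2.6] [cite: Howard2004HeegnerKolyvagin, Thm. 2.1.11 (arXiv:1202.6340 p. 6)]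
[cite: Kobayashi2003, (7.17)–(7.21), (8.23) (p. 18)] [cite: Sprung2012, Def. 7.9 and Def. 7.11 (p. 1503)] -/
theorem levelwise_of_orth (hκ : κ.IsCyclotomic) (hv : (p : 𝓞 ℚ) ∈ v.asIdeal)
    (hg : κ.IsTopGenerator (resGalOfEmb (closureEmb (K := ℚ) (v.adicCompletion ℚ)) g)) (hap : (p : ℤ) ∣ ap)
    (hc : ∀ n, c n ∈ localLayerPointsOfEmb κ (closureEmb (K := ℚ) (v.adicCompletion ℚ)) W n)
    (hTr : ∀ n, 1 ≤ n → localTraceOfEmb κ (closureEmb (K := ℚ) (v.adicCompletion ℚ)) W n (n + 1) (c (n + 1)) =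
      ap • c n - c (n - 1))
    (w : localTowerPointsOfEmb κ (closureEmb (K := ℚ) (v.adicCompletion ℚ)) W →+ ℤ_[p])
    (hw : ∀ (s : sharpFlatSelmerInfty W κ (closureEmb (K := ℚ) (v.adicCompletion ℚ)) ap g c .flat)
      (φ : contOneCocycles (discreteTopRep κ.kerSubgroup (W.geomPrimaryTorsion p)))
      (Q : localPoints W (v.adicCompletion ℚ)) (k : ℕ)
      (hQ : (p ^ k) • Q ∈ localTowerPointsOfEmb κ (closureEmb (K := ℚ) (v.adicCompletion ℚ)) W),
      oneCocycleClass (discreteTopRep κ.kerSubgroup (W.geomPrimaryTorsion p)) φ = (s : W.subgroupH1 p κ.kerSubgroup) →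
      (∀ τ : localSubgroupOfEmb κ.kerSubgroup (closureEmb (K := ℚ) (v.adicCompletion ℚ)),
        pointsMapOfEmb W (closureEmb (K := ℚ) (v.adicCompletion ℚ))
            ((φ.1 (resGalSubgroupOfEmb κ.kerSubgroup _ τ) : W.geomPrimaryTorsion p) : W.geomPoints) =
          (τ : absoluteGaloisGroup (v.adicCompletion ℚ)) • Q - Q) →
      PadicInt.toZModPow k (w ⟨(p ^ k) • Q, hQ⟩) = 0) :
    ∀ n k : ℕ, ∃ a : W.torsionH1Over ((p : ℤ) ^ k) (κ.layerSubgroup n),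
      a ∈ integralH1 (W.torsionGaloisModule ((p : ℤ) ^ k)) p (κ.layerSubgroup n) ∧
      ∀ (Q : localPoints W (v.adicCompletion ℚ))
        (hQ : Q ∈ localLayerPointsOfEmb κ (closureEmb (K := ℚ) (v.adicCompletion ℚ)) W n),
        (∀ z' ∈ colemanKer κ (closureEmb (K := ℚ) (v.adicCompletion ℚ)) W ap g c .flat,
          (p : ℤ_[p]) ^ k ∣ z' ⟨Q, localLayerPointsOfEmb_le_localTowerPointsOfEmb κ _ W n hQ⟩) →
        CyclotomicLayer.layerPairingMod W (p ^ k) (CyclotomicLayer.weilTowerPk W k) (CyclotomicLayer.weilTowerPk_pow W k)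
            (CyclotomicLayer.weilTowerPk_add_left W k) (CyclotomicLayer.weilTowerPk_add_right W k)
            (CyclotomicLayer.weilTowerPk_smul W k) κ v n a ⟨Q, hQ⟩ =
          PadicInt.toZModPow k (w ⟨Q, localLayerPointsOfEmb_le_localTowerPointsOfEmb κ _ W n hQ⟩) := by
  intro n k
  /- ### Level `(n, k)`: representatives of `Γ_ℚ ⧸ Γ_n`, THE Weil pairing `e_{p^k}`, the dual transport `T_v` -/
  have hp : (p : ℕ).Prime := Fact.out
  haveI : NeZero (p ^ k) := ⟨pow_ne_zero k hp.ne_zero⟩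
  haveI : CompactSpace (absoluteGaloisGroup ℚ) := absoluteGaloisGroup_compactSpace ℚ
  haveI : Finite (geomTorsion W ((p ^ k : ℕ) : ℤ)) := finite_geomTorsion_of_neZero W (p ^ k)
  haveI : (κ.layerSubgroup n).FiniteIndex := finiteIndex_of_isOpen_of_compactSpace _ (κ.isOpen_layerSubgroup n)
  letI : Fintype (absoluteGaloisGroup ℚ ⧸ κ.layerSubgroup n) := Fintype.ofFinite _
  obtain ⟨s, hs, hs1⟩ := exists_reps_one (κ.layerSubgroup n)
  let ι := closureEmb (K := ℚ) (v.adicCompletion ℚ)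
  have hnondeg : ∀ T : geomTorsion W (p ^ k), (∀ S, weilTowerPk (p := p) W k S T = 1) → T = 0 :=
    weilTowerPk_nondegenerate W k
  obtain ⟨Tv, hTinj, hTpair⟩ := exists_injective_dualTransport W (p ^ k) (weilTowerPk (p := p) W k) (weilTowerPk_pow W k)
    (weilTowerPk_add_left W k) (weilTowerPk_add_right W k) (weilTowerPk_smul W k) κ v hκ hv hnondeg n
  have hM : ∀ m : absoluteGaloisGroup ℚ ⧸ κ.layerSubgroup n → geomTorsion W (p ^ k : ℕ), (p ^ k) • m = 0 := fun φ =>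
    funext fun y => AddSubgroup.torsionBy.nsmul (φ y)
  /- ### the ♭-test subgroup `T♭`, the classes `c_Q = T_v (Sh_v (κ Q))`, the subgroup `C` and the character `χ_w` -/
  let Tfl : AddSubgroup (localLayerPointsOfEmb κ ι W n) :=
    { carrier := {Q | ∀ z' ∈ colemanKer κ ι W ap g c .flat,
        (p : ℤ_[p]) ^ k ∣ z' ⟨(Q : localPoints W (v.adicCompletion ℚ)), localLayerPointsOfEmb_le_localTowerPointsOfEmb κ _ W n Q.2⟩}
      zero_mem' := fun z' _ => by
        have h0 : (⟨((0 : localLayerPointsOfEmb κ ι W n) : localPoints W (v.adicCompletion ℚ)),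
            localLayerPointsOfEmb_le_localTowerPointsOfEmb κ _ W n (0 : localLayerPointsOfEmb κ ι W n).2⟩ :
            localTowerPointsOfEmb κ ι W) = 0 := rfl
        rw [h0, map_zero]; exact dvd_zero _
      add_mem' := fun {Q₁ Q₂} h₁ h₂ z' hz' => by
        have h12 : (⟨((Q₁ + Q₂ : localLayerPointsOfEmb κ ι W n) : localPoints W (v.adicCompletion ℚ)),
            localLayerPointsOfEmb_le_localTowerPointsOfEmb κ _ W n (Q₁ + Q₂).2⟩ : localTowerPointsOfEmb κ ι W) =
            ⟨(Q₁ : localPoints W (v.adicCompletion ℚ)), localLayerPointsOfEmb_le_localTowerPointsOfEmb κ _ W n Q₁.2⟩ +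
              ⟨(Q₂ : localPoints W (v.adicCompletion ℚ)), localLayerPointsOfEmb_le_localTowerPointsOfEmb κ _ W n Q₂.2⟩ := rfl
        rw [h12, map_add]; exact dvd_add (h₁ z' hz') (h₂ z' hz')
      neg_mem' := fun {Q₁} h₁ z' hz' => by
        have hneg : (⟨((-Q₁ : localLayerPointsOfEmb κ ι W n) : localPoints W (v.adicCompletion ℚ)),
            localLayerPointsOfEmb_le_localTowerPointsOfEmb κ _ W n (-Q₁).2⟩ : localTowerPointsOfEmb κ ι W) =
            -⟨(Q₁ : localPoints W (v.adicCompletion ℚ)), localLayerPointsOfEmb_le_localTowerPointsOfEmb κ _ W n Q₁.2⟩ := rfl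
        rw [hneg, map_neg]; exact (dvd_neg).2 (h₁ z' hz') }
  have hTfl : ∀ Q : localLayerPointsOfEmb κ ι W n, Q ∈ Tfl ↔ ∀ z' ∈ colemanKer κ ι W ap g c .flat,
      (p : ℤ_[p]) ^ k ∣ z' ⟨(Q : localPoints W (v.adicCompletion ℚ)), localLayerPointsOfEmb_le_localTowerPointsOfEmb κ _ W n Q.2⟩ :=
    fun Q => Iff.rfl
  let fE : Tfl →+ galoisCohomology
      ((((W.torsionGaloisModule ((p ^ k : ℕ) : ℤ)).coind (κ.layerSubgroup n) (κ.isOpen_layerSubgroup n)).tateDual (p ^ k)).toLocal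
        (Sum.inr v)) 1 :=
    (Tv.comp ((layerShapiro W (p ^ k) κ v n).toAddMonoidHom.comp (layerKummer W (p ^ k) κ v n))).comp Tfl.subtype
  let C := fE.range
  let χ₀ : Tfl →+ ZMod (p ^ k) :=
    (PadicInt.toZModPow k).toAddMonoidHom.comp
      (w.comp ((AddSubgroup.inclusion (localLayerPointsOfEmb_le_localTowerPointsOfEmb κ ι W n)).comp Tfl.subtype))
  have hχ₀ : ∀ Q : Tfl, χ₀ Q = PadicInt.toZModPow k
      (w ⟨(Q : localLayerPointsOfEmb κ ι W n), localLayerPointsOfEmb_le_localTowerPointsOfEmb κ _ W n (Q : localLayerPointsOfEmb κ ι W n).2⟩) :=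
    fun Q => rfl
  -- `χ₀` kills the kernel of `fE` (the Kummer kernel `p^k·E(ℚ_{n,v})`)
  have hker : ∀ Q : Tfl, fE Q = 0 → χ₀ Q = 0 := by
    intro Q hQ
    have h1 : layerShapiro W (p ^ k) κ v n (layerKummer W (p ^ k) κ v n (Q : localLayerPointsOfEmb κ ι W n)) = 0 :=
      hTinj (by rw [map_zero]; exact hQ)
    have h2 : layerKummer W (p ^ k) κ v n (Q : localLayerPointsOfEmb κ ι W n) = 0 :=
      shapiroLift_injective _ _ _ _ _ (by rw [map_zero]; exact h1)
    have h3 := toZModPow_mul_eq_zero_of_layerKummer_eq_zero W (p ^ k) κ v n k 0 rfl w _ (Q : localLayerPointsOfEmb κ ι W n).2 h2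
    rw [pow_zero, one_mul] at h3
    rw [hχ₀]
    exact h3
  have hker' : fE.ker ≤ χ₀.ker := fun Q hQ => (AddMonoidHom.mem_ker).mpr (hker Q ((AddMonoidHom.mem_ker).mp hQ))
  let eqv : Tfl ⧸ fE.ker ≃+ fE.range := QuotientAddGroup.quotientKerEquivRange fE
  let χ : C →+ ZMod (p ^ k) := (QuotientAddGroup.lift fE.ker χ₀ hker').comp eqv.symm.toAddMonoidHom
  have hχval : ∀ Q : Tfl, χ ⟨fE Q, ⟨Q, rfl⟩⟩ = χ₀ Q := by
    intro Q
    have heq : eqv (QuotientAddGroup.mk Q) = ⟨fE Q, ⟨Q, rfl⟩⟩ := rfl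
    change QuotientAddGroup.lift fE.ker χ₀ hker' (eqv.symm ⟨fE Q, ⟨Q, rfl⟩⟩) = χ₀ Q
    rw [← heq, AddEquiv.symm_apply_apply, QuotientAddGroup.lift_mk]
  /- ### The finite set `S = {∞} ∪ {p} ∪ bad` and the Selmer structures `𝓕 ≤ 𝓖` on `ρc` -/
  have hSfin : ({u : HeightOneSpectrum (𝓞 ℚ) | ((p : ℕ) : 𝓞 ℚ) ∈ u.asIdeal} ∪ W.badPlaces (𝓞 ℚ)).Finite := by
    refine Set.Finite.union ?_ (W.finite_badPlaces_holds (𝓞 ℚ))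
    have hpne : ((p : ℕ) : 𝓞 ℚ) ≠ 0 := by exact_mod_cast hp.ne_zero
    have hne : Ideal.span {((p : ℕ) : 𝓞 ℚ)} ≠ ⊥ := fun h ↦ hpne (Ideal.span_singleton_eq_bot.mp h)
    refine (Ideal.finite_factors hne).subset fun u hu ↦ ?_
    simp only [Set.mem_setOf_eq] at hu ⊢
    exact Ideal.dvd_iff_le.mpr ((Ideal.span_singleton_le_iff_mem _).mpr hu)
  let S : Finset (Place ℚ) := (Finset.univ : Finset (InfinitePlace ℚ)).image Sum.inl ∪ hSfin.toFinset.image Sum.inr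
  have hSinl : ∀ u : InfinitePlace ℚ, (Sum.inl u : Place ℚ) ∈ S := fun u =>
    Finset.mem_union_left _ (Finset.mem_image_of_mem _ (Finset.mem_univ u))
  have hSinr : ∀ u : HeightOneSpectrum (𝓞 ℚ), (Sum.inr u : Place ℚ) ∈ S ↔
      u ∈ ({u : HeightOneSpectrum (𝓞 ℚ) | ((p : ℕ) : 𝓞 ℚ) ∈ u.asIdeal} ∪ W.badPlaces (𝓞 ℚ)) := by
    intro u
    constructor
    · intro h
      rcases Finset.mem_union.mp h with h | h
      · obtain ⟨u', -, hu'⟩ := Finset.mem_image.mp h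
        exact absurd hu' Sum.inl_ne_inr
      · obtain ⟨u', hu', heq⟩ := Finset.mem_image.mp h
        rw [← Sum.inr_injective heq]
        exact hSfin.mem_toFinset.mp hu'
    · exact fun h => Finset.mem_union_right _ (Finset.mem_image_of_mem _ (hSfin.mem_toFinset.mpr h))
  have hvS : v ∈ ({u : HeightOneSpectrum (𝓞 ℚ) | ((p : ℕ) : 𝓞 ℚ) ∈ u.asIdeal} ∪ W.badPlaces (𝓞 ℚ)) :=
    Set.mem_union_left _ (hv : v ∈ {u : HeightOneSpectrum (𝓞 ℚ) | ((p : ℕ) : 𝓞 ℚ) ∈ u.asIdeal})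
  have hv₀ : (Sum.inr v : Place ℚ) ∈ S := (hSinr v).mpr hvS
  -- `𝓖`: everything at `∞` and above `p`, UNRAMIFIED at every finite `u ∌ p` (bad places included)
  let 𝓖 : SelmerStructure ((W.torsionGaloisModule ((p ^ k : ℕ) : ℤ)).coind (κ.layerSubgroup n) (κ.isOpen_layerSubgroup n)) :=
    fun u => match u with
      | Sum.inl _ => ⊤
      | Sum.inr u => if ((p : ℕ) : 𝓞 ℚ) ∈ u.asIdeal then ⊤ else
          unramifiedSubgroup (GaloisRep.toLocal u
            ((W.torsionGaloisModule ((p ^ k : ℕ) : ℤ)).coind (κ.layerSubgroup n) (κ.isOpen_layerSubgroup n))) 1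
  have h𝓖inl : ∀ u : InfinitePlace ℚ, 𝓖 (Sum.inl u) = ⊤ := fun _ => rfl
  have h𝓖p : ∀ u : HeightOneSpectrum (𝓞 ℚ), ((p : ℕ) : 𝓞 ℚ) ∈ u.asIdeal → 𝓖 (Sum.inr u) = ⊤ := fun u hu => if_pos hu
  have h𝓖np : ∀ u : HeightOneSpectrum (𝓞 ℚ), ((p : ℕ) : 𝓞 ℚ) ∉ u.asIdeal → 𝓖 (Sum.inr u) =
      unramifiedSubgroup (GaloisRep.toLocal u
        ((W.torsionGaloisModule ((p ^ k : ℕ) : ℤ)).coind (κ.layerSubgroup n) (κ.isOpen_layerSubgroup n))) 1 :=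
    fun u hu => if_neg hu
  -- `C^⊥` for THE local Tate pairing at `v`
  let Cperp : AddSubgroup (galoisCohomology
      (((W.torsionGaloisModule ((p ^ k : ℕ) : ℤ)).coind (κ.layerSubgroup n) (κ.isOpen_layerSubgroup n)).toLocal (Sum.inr v)) 1) :=
    { carrier := {a | ∀ c ∈ C, localTatePairingZMod
          ((W.torsionGaloisModule ((p ^ k : ℕ) : ℤ)).coind (κ.layerSubgroup n) (κ.isOpen_layerSubgroup n)) (p ^ k) (Sum.inr v)
          (LocalInvariants.canonical ℚ (p ^ k) (Sum.inr v)) a c = 0}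
      zero_mem' := fun c _ => by simp only [map_zero, AddMonoidHom.zero_apply]
      add_mem' := fun {a b} ha hb c hc => by simp only [map_add, AddMonoidHom.add_apply, ha c hc, hb c hc, add_zero]
      neg_mem' := fun {a} ha c hc => by simp only [map_neg, AddMonoidHom.neg_apply, ha c hc, neg_zero] }
  -- `𝓕`: `𝓖` with `𝓕_v := C^⊥`
  let 𝓕 : SelmerStructure ((W.torsionGaloisModule ((p ^ k : ℕ) : ℤ)).coind (κ.layerSubgroup n) (κ.isOpen_layerSubgroup n)) :=
    Function.update 𝓖 (Sum.inr v) Cperp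
  have h𝓕v : 𝓕 (Sum.inr v) = Cperp := Function.update_self _ _ _
  have h𝓕ne : ∀ u : Place ℚ, u ≠ Sum.inr v → 𝓕 u = 𝓖 u := fun u hu => Function.update_of_ne hu _ _
  have hle : 𝓕 ≤ 𝓖 := by
    intro u
    rcases eq_or_ne u (Sum.inr v) with rfl | hu
    · rw [h𝓕v, h𝓖p v hv]; exact le_top
    · rw [h𝓕ne u hu]
  have h𝓖 : 𝓖.IsUnramifiedOutside S :=
    ⟨hSinl, fun u hu => h𝓖np u fun h => hu ((hSinr u).mpr (Set.mem_union_left _ h))⟩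
  have h𝓕 : 𝓕.IsUnramifiedOutside S := by
    refine ⟨hSinl, fun u hu => ?_⟩
    have hne : (Sum.inr u : Place ℚ) ≠ Sum.inr v := fun h => hu (by rw [h]; exact hv₀)
    rw [h𝓕ne _ hne]
    exact h𝓖np u fun h => hu ((hSinr u).mpr (Set.mem_union_left _ h))
  have hS' : ∀ u : HeightOneSpectrum (𝓞 ℚ), (Sum.inr u : Place ℚ) ∉ S →
      ((p ^ k : ℕ) : 𝓞 ℚ) ∉ u.asIdeal ∧
        GaloisRep.IsUnramifiedAt u ((W.torsionGaloisModule ((p ^ k : ℕ) : ℤ)).coind (κ.layerSubgroup n) (κ.isOpen_layerSubgroup n)) := by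
    intro u hu
    have hu' : u ∉ ({u : HeightOneSpectrum (𝓞 ℚ) | ((p : ℕ) : 𝓞 ℚ) ∈ u.asIdeal} ∪ W.badPlaces (𝓞 ℚ)) :=
      fun h => hu ((hSinr u).mpr h)
    obtain ⟨hpu, hgood⟩ := not_mem_and_hasGoodReductionAt_of_not_mem_union (A := W) (p := p) hu'
    refine ⟨fun h => hpu (u.isPrime.mem_of_pow_mem k ?_), ?_⟩
    · rw [← Nat.cast_pow]; exact h
    · exact isUnramifiedAt_coind_torsionGaloisModule_layerSubgroup (W := W) (κ := κ) n k hpu hgood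
  -- `(p^k) ∉ u` for every `u ∌ p`
  have hpku : ∀ u : HeightOneSpectrum (𝓞 ℚ), ((p : ℕ) : 𝓞 ℚ) ∉ u.asIdeal → ((p ^ k : ℕ) : 𝓞 ℚ) ∉ u.asIdeal := by
    intro u hpu h
    refine hpu (u.isPrime.mem_of_pow_mem k ?_)
    rw [← Nat.cast_pow]; exact h
  have h𝓖v : 𝓖 (Sum.inr v) = ⊤ := h𝓖p v hv
  have h𝓕v' : ∀ a, a ∈ 𝓕 (Sum.inr v) ↔ ∀ c ∈ C, localTatePairingZMod
      ((W.torsionGaloisModule ((p ^ k : ℕ) : ℤ)).coind (κ.layerSubgroup n) (κ.isOpen_layerSubgroup n)) (p ^ k) (Sum.inr v)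
      (LocalInvariants.canonical ℚ (p ^ k) (Sum.inr v)) a c = 0 := fun a => by rw [h𝓕v]; rfl
  /- ### Orthogonality: `χ_w` kills `loc_v y` for every `y ∈ H¹_{𝓕^*}(ℚ, ρc^D)` — Milne I 2.6 (ramified-safe) + (T♭) -/
  have hχ : ∀ y ∈ ((LocalInvariants.canonical ℚ (p ^ k)).dualSelmerStructure
        ((W.torsionGaloisModule ((p ^ k : ℕ) : ℤ)).coind (κ.layerSubgroup n) (κ.isOpen_layerSubgroup n)) 𝓕).selmerGroup,
      ∀ hy : galoisCohomology.localization
          (((W.torsionGaloisModule ((p ^ k : ℕ) : ℤ)).coind (κ.layerSubgroup n) (κ.isOpen_layerSubgroup n)).tateDual (p ^ k))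
          (Sum.inr v) 1 y ∈ C,
        χ ⟨galoisCohomology.localization
          (((W.torsionGaloisModule ((p ^ k : ℕ) : ℤ)).coind (κ.layerSubgroup n) (κ.isOpen_layerSubgroup n)).tateDual (p ^ k))
          (Sum.inr v) 1 y, hy⟩ = 0 := by
    intro y hy hyC
    -- `y = H¹(Ψ) (Sh b)`
    obtain ⟨b, hb, -⟩ := existsUnique_shapiroLift_coindTateDual_eq W (p ^ k) (weilTowerPk (p := p) W k) (weilTowerPk_pow W k)
      (weilTowerPk_add_left W k) (weilTowerPk_add_right W k) (weilTowerPk_smul W k) κ hnondeg n hs hs1 y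
    subst hb
    -- `loc_v y = fE Q₀`, `Q₀ ∈ T♭`
    obtain ⟨Q₀, hQ₀⟩ := AddMonoidHom.mem_range.mp hyC
    have hyC' : (⟨_, hyC⟩ : C) = ⟨fE Q₀, ⟨Q₀, rfl⟩⟩ := Subtype.ext hQ₀.symm
    rw [hyC', hχval, hχ₀]
    have hyloc := (SelmerStructure.mem_selmerGroup_iff _ _).mp hy
    -- [int] `b` is integral at EVERY `u ∌ p` (the dual of «unramified» is «unramified», ramified `ρc` allowed; then §1)
    have hint : ∀ u : HeightOneSpectrum (𝓞 ℚ), ((p : ℕ) : 𝓞 ℚ) ∉ u.asIdeal → ∀ 𝔓 ∈ u.primesAbove,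
        resLe (W.torsionGaloisModule ((p : ℤ) ^ k)).toTopRep
          (inf_le_left : κ.layerSubgroup n ⊓ 𝔓.inertia (absoluteGaloisGroup ℚ) ≤ κ.layerSubgroup n) 1 b = 0 := by
      intro u hpu
      have hne : (Sum.inr u : Place ℚ) ≠ Sum.inr v := fun h => hpu (by rw [Sum.inr_injective h]; exact hv)
      have h1 := hyloc (Sum.inr u)
      rw [LocalInvariants.dualSelmerStructure_apply, h𝓕ne _ hne, h𝓖np u hpu,
        PoitouTateReduction.dualLocalCondition_canonical_unramifiedSubgroup_eq_of_primePow (K := ℚ) (n := p ^ k) ⟨k, rfl⟩ _ hM u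
          (hpku u hpu)] at h1
      have h2 := localization_mem_unramifiedSubgroup_of_coindTateDual W (p ^ k) (weilTowerPk (p := p) W k) (weilTowerPk_pow W k)
        (weilTowerPk_add_left W k) (weilTowerPk_add_right W k) (weilTowerPk_smul W k) (κ.layerSubgroup n)
        (κ.isOpen_layerSubgroup n) hnondeg u _ h1
      exact forall_primesAbove_resLe_eq_zero_of_localization_shapiroLift_mem
        (isOpen_stabilizer_geomTorsion' W ((p ^ k : ℕ) : ℤ)) (κ.layerSubgroup n) (κ.isOpen_layerSubgroup n) hs hs1 u b h2
    -- [inf] `b` is locally trivial at the infinite place (`⊤^⊥ = 0`, Milne I 2.13 + (E1c))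
    have hinf : ∀ (u : InfinitePlace ℚ) (σ : absoluteGaloisGroup ℚ),
        resOfLe (geomTorsion W ((p : ℤ) ^ k)) (inf_le_left : κ.layerSubgroup n ⊓ decompInf u ≤ κ.layerSubgroup n)
          (conjH1 (κ.layerSubgroup n) (geomTorsion W ((p : ℤ) ^ k)) σ b) = 0 := by
      intro u
      have h1 := hyloc (Sum.inl u)
      rw [LocalInvariants.dualSelmerStructure_apply, h𝓕ne _ Sum.inl_ne_inr, h𝓖inl u,
        LocalInvariants.mem_dualLocalCondition_iff] at h1
      have h2 := eq_zero_of_forall_localTatePairingZMod_canonical_inl_eq_zero (p ^ k) _ hM u _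
        fun a => h1 a (AddSubgroup.mem_top a)
      exact fun σ => resOfLe_decompInf_conjH1_eq_zero_of_localization_shapiroLift_eq_zero W _ κ n hs hs1 u b
        (localization_eq_zero_of_localization_coindTateDual_eq_zero W (p ^ k) (weilTowerPk (p := p) W k) (weilTowerPk_pow W k)
          (weilTowerPk_add_left W k) (weilTowerPk_add_right W k) (weilTowerPk_smul W k) (κ.layerSubgroup n)
          (κ.isOpen_layerSubgroup n) hnondeg (Sum.inl u) _ h2) σ
    -- [kum] the layer localisation of `b` at `v` is the Kummer class of `Q₀` (characters + non-degeneracy of the layer pairing)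
    have hkum : layerLoc W (p ^ k) κ v n b = layerKummer W (p ^ k) κ v n (Q₀ : localLayerPointsOfEmb κ ι W n) := by
      have hsub : layerShapiro W (p ^ k) κ v n (layerLoc W (p ^ k) κ v n b) -
          layerShapiro W (p ^ k) κ v n (layerKummer W (p ^ k) κ v n (Q₀ : localLayerPointsOfEmb κ ι W n)) = 0 := by
        refine eq_zero_of_forall_invAt_cupProduct_pull_eq_zero W (p ^ k) (weilTowerPk (p := p) W k) (weilTowerPk_pow W k)
          (weilTowerPk_add_left W k) (weilTowerPk_add_right W k) (weilTowerPk_smul W k) κ v hκ hv hnondeg n _ fun a' => ?_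
        rw [map_sub, map_sub,
          ← localTatePairingZMod_canonical_localization_coindTateDual_shapiroLift W (p ^ k) (weilTowerPk (p := p) W k)
            (weilTowerPk_pow W k) (weilTowerPk_add_left W k) (weilTowerPk_add_right W k) (weilTowerPk_smul W k) κ v hκ hv n
            hs hs1 a' b,
          ← hTpair, ← hQ₀]
        exact sub_self _
      rw [← map_sub] at hsub
      exact sub_eq_zero.mp (shapiroLift_injective _ _ _ _ _ (hsub.trans (map_zero _).symm))
    -- (T♭): ORTH `w` read at the layer, `m₀ = 0`
    exact toZModPow_apply_eq_zero_of_orth_of_integral W κ v hκ hv hap hg hc hTr w hw n k b hint hinf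
      (Q₀ : localLayerPointsOfEmb κ ι W n) (Q₀ : localLayerPointsOfEmb κ ι W n).2 hkum ((hTfl _).1 Q₀.2)
  /- ### The one-place lift (Milne I 4.10 (b) for THE maps) and the output class `a = Sh⁻¹ X` -/
  obtain ⟨X, hX𝓖, hXval, -⟩ :=
    LocalInvariants.exists_selmer_canonical_localTatePairing_eq_of_subgroup
      (SchneiderFreeAdditiveX3.PoitouTateReduction.poitouTate_selmerStructure_duality_real_holds ℚ) _ hM hS' hle h𝓕 h𝓖 hv₀ h𝓖v
      C h𝓕v' χ hχ
  obtain ⟨a, ha⟩ := shapiroLift_surjective (W.torsionGaloisModule ((p ^ k : ℕ) : ℤ)).toTopRep (κ.layerSubgroup n)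
    (κ.isOpen_layerSubgroup n) hs hs1 X
  have hXloc := (SelmerStructure.mem_selmerGroup_iff _ _).mp hX𝓖
  refine ⟨a, ?_, fun Q hQ htest => ?_⟩
  · -- integrality of `a` (X ∈ H¹_𝓖: unramified at every finite `u ∌ p`; ramified-safe transport §1)
    refine (mem_integralH1_iff _ p _ _).mpr fun u hu 𝔓 h𝔓 => ?_
    have hpu : ((p : ℕ) : 𝓞 ℚ) ∉ u.asIdeal := WeierstrassCurve.natCast_not_mem_asIdeal_of_primesEquiv_ne hp hu
    have h1 := hXloc (Sum.inr u)
    rw [h𝓖np u hpu, ← ha] at h1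
    exact forall_primesAbove_resLe_eq_zero_of_localization_shapiroLift_mem
      (isOpen_stabilizer_geomTorsion' W ((p ^ k : ℕ) : ℤ)) (κ.layerSubgroup n) (κ.isOpen_layerSubgroup n) hs hs1 u a h1 𝔓 h𝔓
  · -- the pairing value: `⟨a, Q⟩_{n,p^k} = ⟨loc_v X, c_Q⟩_v = χ_w(c_Q) = w(Q) mod p^k`
    have hQT : (⟨Q, hQ⟩ : localLayerPointsOfEmb κ ι W n) ∈ Tfl := (hTfl _).2 htest
    rw [layerPairingMod_apply, ← cohomologyMap_coindFinPull_localization_shapiroLift W (p ^ k) κ v hκ hv n hs hs1 a, ← hTpair, ha]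
    exact (hXval _ ⟨⟨_, hQT⟩, rfl⟩).trans ((hχval ⟨_, hQT⟩).trans (hχ₀ ⟨_, hQT⟩))

end SSFlatPT

end Summit.BirchSwinnertonDyer.BirchSwinnertonDyer.Theorems

end
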